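import Literature.Analysis.FluidPDE.LocalTypeIProofs
import Literature.Analysis.FluidPDE.LocalTypeIScaling
import HarnessLib

/-!
# Crux `HubbleDynamo.FarFieldSlaving` (stmt-NavierStokesRegularity-1935): marked scales of a
# violation (two-point reduction, bookkeeping file)

Helper file (theorems only; no Navier–Stokes content): the elementary selection of scales and
marked points used by `hubbleDynamo_exists_twoPointModel` (`HubbleDynamoFarFieldSlavingTwoPointZoom`),
the identity between translated zoom-ins and zooms about translated centres, and the inclusion of
the translated image balls in `Q(0, 1/2)`.
-/

noncomputable section

set_option linter.dupNamespace false

open MeasureTheory Set Function Filter TopologicalSpace Metric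
open scoped Topology NNReal ENNReal InnerProductSpace RealInnerProductSpace

namespace Summit.NavierStokesRegularity.NavierStokesRegularity.Theorems

open Literature.Analysis Literature.Analysis.FluidPDE

/-- **The translated zoom-in is a zoom about a translated centre**: for the unit zoom
`v = α • stPull β R T x₀ u`, the zoom-in by `c` about `(0, c • e)` equals the zoom sequence
element about the physical centre `x₀ + (cR) • e`, and is the space translate by `e` of the zoom
about `x₀`. [folklore] -/
theorem zoomInAt_smul_eq (T : ℝ) (x₀ e : EuclideanSpace ℝ (Fin 3))
    (u : ℝ → EuclideanSpace ℝ (Fin 3) → EuclideanSpace ℝ (Fin 3)) (α β R c t : ℝ)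
    (x : EuclideanSpace ℝ (Fin 3)) :
    (c • stPull (c ^ 2) c 0 (c • e) (α • stPull β R T x₀ u)) t x =
      ((c * α) • stPull (c ^ 2 * β) (c * R) T x₀ u) t (x + e) := by
  have h1 : β * (c ^ 2 * t) = c ^ 2 * β * t := by ring
  have h2 : (R * c) • e + (R * c) • x = (c * R) • x + (c * R) • e := by rw [mul_comm R c, add_comm]
  simp only [smul_stPull_apply, zero_add, smul_smul, smul_add, h1, h2]

/-- The image ball of the translated zoom-in lies in `Q(0, 1/2)`: for `0 < c ≤ 2/5` and
`‖e‖ = 1/4`, `Q((0, c • e), c) ⊆ Q(0, 1/2)` (`c² ≤ 1/4` and `c + c/4 ≤ 1/2`). [folklore] -/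
theorem parabolicCylinder_smul_subset_half {c : ℝ} (hc : 0 < c) (hc25 : c ≤ 2 / 5)
    {e : EuclideanSpace ℝ (Fin 3)} (he : ‖e‖ = 1 / 4) :
    parabolicCylinder c (((0 : ℝ), c • e) : ℝ × EuclideanSpace ℝ (Fin 3)) ⊆
      parabolicCylinder (1 / 2) (0 : ℝ × EuclideanSpace ℝ (Fin 3)) := by
  intro z hz
  rw [mem_parabolicCylinder] at hz
  rw [SuitableCompactness.mem_parabolicCylinder_zero]
  obtain ⟨⟨hz1, hz2⟩, hz3⟩ := hz
  refine ⟨⟨?_, by simpa using hz2⟩, ?_⟩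
  · have h1 : (0 : ℝ) - c ^ 2 < z.1 := hz1
    nlinarith
  · have h1 : dist z.2 (c • e) < c := hz3
    have h2 : ‖z.2‖ ≤ dist z.2 (c • e) + ‖c • e‖ := by
      rw [dist_eq_norm]
      exact norm_le_norm_sub_add _ _
    have h3 : ‖c • e‖ = c * (1 / 4) := by rw [norm_smul, Real.norm_eq_abs, abs_of_pos hc, he]
    nlinarith

/-- **Marked scales of a violation of far-field slaving.** If the bound
`‖u t x‖ ≤ C / (‖x − x₀‖ + √(T − t))` fails on every cylinder `Q_δ'(T, x₀)` for every `C`, then for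
any zoom parameters `R, α, β, δ > 0` there are scales `0 < c_k ≤ 2/5`, `c_k → 0`, and marked
points `(σ_k, η_k)` of zoomed parabolic size `‖η_k‖ + √(−σ_k) = 1/4` inside the final windows
`(−δ/(c_k² β), 0)` at which the zooms `w_k = (c_k α) • u ∘ Φ_{c_k}` about `(T, x₀)` take values of
norm `→ ∞` (violating points with `C = k` on `Q_{d/(k+1)}(T, x₀)`, `c_k` four times their
parabolic size in the unit zoom). [folklore] -/
theorem hubbleDynamo_exists_markedScales {T : ℝ}
    {u : ℝ → EuclideanSpace ℝ (Fin 3) → EuclideanSpace ℝ (Fin 3)} (x₀ : EuclideanSpace ℝ (Fin 3))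
    {R α β δ : ℝ} (hR : 0 < R) (hα : 0 < α) (hβ : 0 < β) (hδ : 0 < δ)
    (hfail : ∀ δ' : ℝ, 0 < δ' → ∀ C : ℝ, ∃ t ∈ Ioo (T - δ' ^ 2) T, ∃ x ∈ ball x₀ δ',
      C / (‖x - x₀‖ + Real.sqrt (T - t)) < ‖u t x‖) :
    ∃ (c σ : ℕ → ℝ) (η : ℕ → EuclideanSpace ℝ (Fin 3)),
      (∀ k, 0 < c k) ∧ (∀ k, c k ≤ 2 / 5) ∧ Tendsto c atTop (𝓝 0) ∧
      (∀ k, σ k ∈ Ioo (-(δ / (c k ^ 2 * β))) 0) ∧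
      (∀ k, ‖η k‖ + Real.sqrt (-(σ k)) = 1 / 4) ∧
      Tendsto (fun k => ‖((c k * α) • stPull (c k ^ 2 * β) (c k * R) T x₀ u) (σ k) (η k)‖)
        atTop atTop := by
  have hsβ : 0 < Real.sqrt β := Real.sqrt_pos.2 hβ
  -- ## (2) the violating points and their scales
  set L : ℝ := max R (Real.sqrt β) with hL
  have hLpos : 0 < L := lt_max_of_lt_left hR
  have hRL : R ≤ L := le_max_left _ _
  have hβL : Real.sqrt β ≤ L := le_max_right _ _
  set κ : ℝ := 1 / R + 1 / Real.sqrt β with hκ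
  have hκpos : 0 < κ := by positivity
  set d : ℝ := min (min 1 δ) ((1 / 10) / κ) with hd
  have hdpos : 0 < d := lt_min (lt_min one_pos hδ) (by positivity)
  have hd1 : d ≤ 1 := (min_le_left _ _).trans (min_le_left _ _)
  have hdδ : d ≤ δ := (min_le_left _ _).trans (min_le_right _ _)
  have hdκ : d * κ ≤ 1 / 10 := by
    have h : d ≤ (1 / 10) / κ := min_le_right _ _
    rwa [le_div_iff₀ hκpos] at h
  set dk : ℕ → ℝ := fun k => d / ((k : ℝ) + 1) with hdk
  have hdkpos : ∀ k, 0 < dk k := fun k => by positivity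
  have hdkd : ∀ k, dk k ≤ d := fun k => by
    rw [hdk]
    exact div_le_self hdpos.le (by linarith [(Nat.cast_nonneg k : (0 : ℝ) ≤ k)])
  have hdklim : Tendsto dk atTop (𝓝 0) :=
    tendsto_const_nhds.div_atTop (tendsto_atTop_add_const_right _ _ tendsto_natCast_atTop_atTop)
  have hex : ∀ k : ℕ, ∃ t ∈ Ioo (T - dk k ^ 2) T, ∃ x ∈ ball x₀ (dk k),
      (k : ℝ) / (‖x - x₀‖ + Real.sqrt (T - t)) < ‖u t x‖ := fun k => hfail (dk k) (hdkpos k) k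
  choose tk htk xk hxk hviol using hex
  have hTt : ∀ k, 0 < T - tk k := fun k => sub_pos.2 (htk k).2
  have hTt' : ∀ k, T - tk k < dk k ^ 2 := fun k => by linarith [(htk k).1]
  have hxk' : ∀ k, ‖xk k - x₀‖ < dk k := fun k => by rw [← dist_eq_norm]; exact hxk k
  set m : ℕ → ℝ := fun k => ‖xk k - x₀‖ + Real.sqrt (T - tk k) with hm
  have hmpos : ∀ k, 0 < m k := fun k =>
    add_pos_of_nonneg_of_pos (norm_nonneg _) (Real.sqrt_pos.2 (hTt k))
  have hbig : ∀ k : ℕ, (k : ℝ) < m k * ‖u (tk k) (xk k)‖ := fun k => by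
    have h := hviol k
    rw [div_lt_iff₀ (hmpos k)] at h
    linarith
  -- zoomed coordinates of the points
  set sk : ℕ → ℝ := fun k => -((T - tk k) / β) with hsk
  set yk : ℕ → EuclideanSpace ℝ (Fin 3) := fun k => R⁻¹ • (xk k - x₀) with hyk
  have hskneg : ∀ k, sk k < 0 := fun k => by simp only [hsk]; exact neg_neg_of_pos (div_pos (hTt k) hβ)
  have hnegsk : ∀ k, -(sk k) = (T - tk k) / β := fun k => by simp only [hsk, neg_neg]
  have htk_eq : ∀ k, T + β * sk k = tk k := fun k => by
    simp only [hsk]; field_simp; ring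
  have hxk_eq : ∀ k, x₀ + R • yk k = xk k := fun k => by
    simp only [hyk, smul_smul, mul_inv_cancel₀ hR.ne', one_smul]; abel
  have hnorm_yk : ∀ k, ‖yk k‖ = ‖xk k - x₀‖ / R := fun k => by
    simp only [hyk, norm_smul, norm_inv, Real.norm_eq_abs, abs_of_pos hR]
    rw [div_eq_inv_mul]
  have hsqrt_sk : ∀ k, Real.sqrt (-(sk k)) = Real.sqrt (T - tk k) / Real.sqrt β := fun k => by
    rw [hnegsk, Real.sqrt_div (hTt k).le]
  set q : ℕ → ℝ := fun k => ‖yk k‖ + Real.sqrt (-(sk k)) with hq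
  have hq_eq : ∀ k, q k = ‖xk k - x₀‖ / R + Real.sqrt (T - tk k) / Real.sqrt β := fun k => by
    simp only [hq, hnorm_yk, hsqrt_sk]
  have hqpos : ∀ k, 0 < q k := fun k => by
    rw [hq_eq]; exact add_pos_of_nonneg_of_pos (by positivity) (div_pos (Real.sqrt_pos.2 (hTt k)) hsβ)
  have hq_ge : ∀ k, m k / L ≤ q k := fun k => by
    rw [hq_eq, hm, add_div]
    exact add_le_add (div_le_div_of_nonneg_left (norm_nonneg _) hR hRL)
      (div_le_div_of_nonneg_left (Real.sqrt_nonneg _) hsβ hβL)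
  have hq_le_dk : ∀ k, q k ≤ dk k * κ := fun k => by
    rw [hq_eq, hκ, mul_add, mul_one_div, mul_one_div]
    refine add_le_add (div_le_div_of_nonneg_right (hxk' k).le hR.le)
      (div_le_div_of_nonneg_right ?_ hsβ.le)
    calc Real.sqrt (T - tk k) ≤ Real.sqrt (dk k ^ 2) := Real.sqrt_le_sqrt (hTt' k).le
      _ = dk k := Real.sqrt_sq (hdkpos k).le
  have hq_le : ∀ k, q k ≤ 1 / 10 := fun k =>
    (hq_le_dk k).trans ((mul_le_mul_of_nonneg_right (hdkd k) hκpos.le).trans hdκ)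
  have hq_lim : Tendsto q atTop (𝓝 0) := by
    have h : Tendsto (fun k => dk k * κ) atTop (𝓝 (0 * κ)) := hdklim.mul_const κ
    rw [zero_mul] at h
    exact tendsto_of_tendsto_of_tendsto_of_le_of_le tendsto_const_nhds h
      (fun k => (hqpos k).le) hq_le_dk
  -- the scales
  set c : ℕ → ℝ := fun k => 4 * q k with hc
  have hcpos : ∀ k, 0 < c k := fun k => by simp only [hc]; linarith [hqpos k]
  have hc25 : ∀ k, c k ≤ 2 / 5 := fun k => by simp only [hc]; linarith [hq_le k]
  have hc2 : ∀ k, c k ≤ 1 / 2 := fun k => (hc25 k).trans (by norm_num)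
  have hclim : Tendsto c atTop (𝓝 0) := by
    have h : Tendsto (fun k => 4 * q k) atTop (𝓝 (4 * 0)) := hq_lim.const_mul 4
    rwa [mul_zero] at h
  -- the zooms and their final windows
  set w : ℕ → ℝ → EuclideanSpace ℝ (Fin 3) → EuclideanSpace ℝ (Fin 3) :=
    fun k => (c k * α) • stPull (c k ^ 2 * β) (c k * R) T x₀ u with hw
  set A : ℕ → ℝ := fun k => -(δ / (c k ^ 2 * β)) with hA
  -- ## (3) the marked points in zoomed coordinates
  set σ : ℕ → ℝ := fun k => sk k / c k ^ 2 with hσ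
  set η : ℕ → EuclideanSpace ℝ (Fin 3) := fun k => (c k)⁻¹ • yk k with hη
  have hσneg : ∀ k, σ k < 0 := fun k => div_neg_of_neg_of_pos (hskneg k) (pow_pos (hcpos k) 2)
  have hσwin : ∀ k, σ k ∈ Ioo (A k) 0 := fun k => by
    refine ⟨?_, hσneg k⟩
    simp only [hA, hσ, hsk]
    have hc2pos : 0 < c k ^ 2 := pow_pos (hcpos k) 2
    have hcb : 0 < c k ^ 2 * β := mul_pos hc2pos hβ
    rw [neg_div, neg_lt_neg_iff, div_lt_div_iff₀ hc2pos hcb]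
    have h1 : T - tk k < δ := by
      have := hTt' k
      have h2 : dk k ^ 2 ≤ d := by
        calc dk k ^ 2 ≤ dk k * 1 := by
              rw [sq]; exact mul_le_mul_of_nonneg_left ((hdkd k).trans hd1) (hdkpos k).le
          _ ≤ d := by rw [mul_one]; exact hdkd k
      linarith
    have h3 : (T - tk k) / β * (c k ^ 2 * β) = (T - tk k) * c k ^ 2 := by field_simp
    rw [h3]
    nlinarith
  have hsize : ∀ k, ‖η k‖ + Real.sqrt (-(σ k)) = 1 / 4 := fun k => by
    have h1 : ‖η k‖ = ‖yk k‖ / c k := by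
      simp only [hη, norm_smul, norm_inv, Real.norm_eq_abs, abs_of_pos (hcpos k)]
      rw [div_eq_inv_mul]
    have h2 : Real.sqrt (-(σ k)) = Real.sqrt (-(sk k)) / c k := by
      simp only [hσ]
      rw [← neg_div, Real.sqrt_div' _ (sq_nonneg _), Real.sqrt_sq (hcpos k).le]
    rw [h1, h2, ← add_div, div_eq_iff (hcpos k).ne']
    show q k = 1 / 4 * (4 * q k)
    ring
  have hval : ∀ k, w k (σ k) (η k) = (c k * α) • u (tk k) (xk k) := fun k => by
    have h1 : T + c k ^ 2 * β * σ k = tk k := by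
      rw [← htk_eq k]
      have hck : c k ^ 2 ≠ 0 := (pow_pos (hcpos k) 2).ne'
      simp only [hσ]
      rw [mul_comm (c k ^ 2) β, mul_assoc, mul_div_cancel₀ _ hck]
    have h2 : x₀ + (c k * R) • η k = xk k := by
      rw [← hxk_eq k]
      simp only [hη, smul_smul]
      rw [mul_comm (c k) R, mul_assoc, mul_inv_cancel₀ (hcpos k).ne', mul_one]
    show (c k * α) • u (T + c k ^ 2 * β * σ k) (x₀ + (c k * R) • η k) = (c k * α) • u (tk k) (xk k)
    rw [h1, h2]
  have hval_gt : ∀ k, 4 * α / L * k < ‖w k (σ k) (η k)‖ := fun k => by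
    rw [hval k, norm_smul, Real.norm_eq_abs, abs_of_pos (mul_pos (hcpos k) hα)]
    have h1 : 4 * α / L * k < 4 * α / L * (m k * ‖u (tk k) (xk k)‖) :=
      mul_lt_mul_of_pos_left (hbig k) (by positivity)
    refine h1.trans_le ?_
    calc 4 * α / L * (m k * ‖u (tk k) (xk k)‖) = 4 * α * ‖u (tk k) (xk k)‖ * (m k / L) := by
          field_simp
      _ ≤ 4 * α * ‖u (tk k) (xk k)‖ * q k :=
          mul_le_mul_of_nonneg_left (hq_ge k) (by positivity)
      _ = c k * α * ‖u (tk k) (xk k)‖ := by simp only [hc]; ring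
  have hval_tendsto : Tendsto (fun k => ‖w k (σ k) (η k)‖) atTop atTop := by
    have h : Tendsto (fun k : ℕ => 4 * α / L * (k : ℝ)) atTop atTop :=
      tendsto_natCast_atTop_atTop.const_mul_atTop (by positivity)
    exact tendsto_atTop_mono (fun k => (hval_gt k).le) h
  exact ⟨c, σ, η, hcpos, hc25, hclim, hσwin, hsize, hval_tendsto⟩

end Summit.NavierStokesRegularity.NavierStokesRegularity.Theorems

end
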